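import Summits.HodgeConjecture.HodgeConjecture.Theorems.K2E5QuatPoissonTransport        -- ★ G11a (p855575): Poisson on `D_h` in coordinates, `tsum_quatRatSubalgebra_eq_tsum_coord`
import Summits.HodgeConjecture.HodgeConjecture.Theorems.K2E5QuatPoissonDilation         -- ★ G11b (p855630): `quatCoord_dilate`, `integral_quatCoord_mul_left` (`∫ Φ(x·) = |x|⁻¹ ∫ Φ`)
import Summits.HodgeConjecture.HodgeConjecture.Theorems.K2E5QuatSchwartzBruhatDilate    -- ★ G11c (p855678): `comp_mul_left_mem_quatSchwartzBruhat` (`Φ(x·) ∈ 𝒮(D_{h,𝔸})`)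
import HarnessLib

/-!
# K2 ∕ E5 «TamagawaUnitary», unit G «ZETA» — R3 `K2E5QuatThetaPoisson`: the theta inversion formula `∑_{ξ ∈ D_h} Φ(xξ) = |x|⁻¹ ν⁴(F)⁻¹ ∑_{ξ ∈ D_h} Φ̂(ξ x⁻¹)`

Cell `hodgecm-mathlib` (Track B «K2-LIT»), item h413 = `stmt-HodgeConjecture-24833`; dealt BY NAME by K2E5-plan (g2), SWEEP #12d (28) (2026-09-04T00:11:12Z),
to base K2E5-p14; author K2E5-p14 (g0).  PROOF lane (theorems only, `--supports stmt-HodgeConjecture-24833 --as helper`).  Rung R3 of the G3 residue ladder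
(lead K2E5-p07 (g0): R0 `K2E5QuatZetaResidueOfParts` ⟸ R1 split, R2 plus-part entire, R3 = THIS, R4 minus-part principal part, R5 head) under socket G3
`Zeta.sig_K2E5QuatZetaResidue` (Tate–Fujisaki for `D_h`, convention-free).

Objects (★ #3g `K2E5QuatZetaDefs`, ★ `K2E5QuatAdelicCoordinates`): `D_{h,𝔸} ⊂ M₂(𝔸_L)`, its unit group `(D_h ⊗ 𝔸)^× = quatAdelicUnits L Ha`, the `L⁺`-basis
`e = quatBasis` of `D_h` and the coordinates `quatCoord L e : 𝔸⁺⁴ → D_{h,𝔸}` with inverse `quatCoordInv` on `D_{h,𝔸}`, the module `|x| = quatModule x = |det x|_{𝔸_L}`,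
the trd-Fourier transform in coordinates `Φ̂(b) = quatFourierCoord L ν4 G e Φ b = ∫ Φ(quatCoord e a) ψ_{L⁺}(∑ᵢ (G b)ᵢ aᵢ) dν4(a)` (`G = quatGramReal`, the Gram matrix
of `trd` on `e`, so `∑ᵢ (G b)ᵢ aᵢ ⊗ 1 = trd(quatCoord e a · quatCoord e b)`, §1), and Tate's covolume factor `ν4(F)⁻¹`, `F = piFundamentalDomain L⁺ (Fin 4)`.

Content:
* §1 `baseChange_sum_gram_mulVec_mul`: the character argument of `quatFourierCoord` IS the reduced-trace pairing, `(∑ᵢ (G b)ᵢ aᵢ) ⊗ 1 = tr(quatCoord e a · quatCoord e b)`.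
* §2 **`quatFourierCoord_comp_mul_left`** — THE FOURIER TRANSFORM OF A DILATED TEST FUNCTION: for `x ∈ (D_h ⊗ 𝔸)^×`,
  `(Φ(x·))̂(b) = |x|⁻¹ · Φ̂(b·x⁻¹)` where `b·x⁻¹` is read in coordinates as `quatCoordInv (quatCoord e b · x⁻¹)` (change of variables ★ `integral_quatCoord_mul_left`
  + cyclicity of the trace `tr(x⁻¹ a b) = tr(a b x⁻¹)` + injectivity of `𝔸⁺ → 𝔸_L`).
* §3 **`tsum_quatRat_mul_left_eq_inv_measure_mul_tsum`** — POISSON FOR `Φ(x·)`: `∑_{ξ ∈ D_h} Φ(x(ξ ⊗ 1)) = ν4(F)⁻¹ ∑_{η ∈ (L⁺)⁴} (Φ(x·))̂(η ⊗ 1)`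
  (★ `tsum_quatRat_eq_inv_measure_mul_tsum_quatFourierCoord_coord` at the Schwartz–Bruhat function `Φ(x·)`, ★ `comp_mul_left_mem_quatSchwartzBruhat`).
* §4 **`tsum_quatRat_mul_left_eq`** ∕ **`tsum_quatRat_mul_left_eq_tsum_quatRat`** — THE THETA INVERSION FORMULA:
  `∑_{ξ ∈ D_h} Φ(x(ξ ⊗ 1)) = ν4(F)⁻¹ · |x|⁻¹ · ∑_{η ∈ (L⁺)⁴} Φ̂((η ⊗ 1)·x⁻¹)` and the same with the dual sum indexed by `y ∈ D_h` (`(y ⊗ 1)·x⁻¹`).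

HONEST LABEL: HC_CM is proved only modulo the 7 printed citations (2 remaining named inputs: hLiu418 = stmt-HodgeConjecture-24832,
h413 = stmt-HodgeConjecture-24833) until rung 0 closes; this file is rung R3 of ONE tier-1 socket's proof ladder and discharges no socket by itself.

AUDIT (materialised pages; `book:vignerasnd-arithmetique-des-algebres-de-quaternions` = V80): V80 p0062.txt–p0063.txt (Ch. III §2, proof of Thm. 2.2: the formula
`∑_{x ∈ X_K} Φ(yx) = ‖y‖⁻¹ ∑_{x ∈ X_K} Φ*(x y⁻¹)` obtained from «la formule de Poisson» applied to `Φ(y·)`, whose transform is `‖y‖⁻¹Φ*(·y⁻¹)`).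

## References
* [VignerasLNM800] M.-F. Vignéras, *Arithmétique des algèbres de quaternions*, LNM 800 (1980) — Ch. II §4 (Φ*), Ch. III §2 Thm. 2.2 (proof).
* [WeilBNT1967] A. Weil, *Basic Number Theory* (1967) — Ch. VII §2 Prop. 2 & Thm. 1 (Fourier transform of `Φ(a·)`), Ch. VII §5–6.
* [TateThesis1967] J. Tate, *Fourier analysis in number fields and Hecke's zeta-functions* — §4.2 (Riemann–Roch / theta formula), Lemma 4.2.4.
* [CasselsFrohlichANT1967] Cassels–Fröhlich (eds.), *Algebraic Number Theory* — Ch. XV Thm. 4.2.1.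
-/

set_option autoImplicit false
set_option linter.dupNamespace false

noncomputable section

namespace Summit.HodgeConjecture.HodgeConjecture.Cruxes.H413.K2E5QuatThetaPoisson

open MeasureTheory Measure NumberField IsDedekindDomain
open Literature.NumberTheory Literature.NumberTheory.Automorphic
open Summit.HodgeConjecture.HodgeConjecture.Cruxes.H413.K2E5QuatAdelicMatrixModel
open Summit.HodgeConjecture.HodgeConjecture.Cruxes.H413.K2E5QuatZeta
open Summit.HodgeConjecture.HodgeConjecture.Cruxes.H413.K2E5QuatAdelicCoordinates
open Summit.HodgeConjecture.HodgeConjecture.Cruxes.H413.K2E5QuatPoissonTransport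
open Summit.HodgeConjecture.HodgeConjecture.Cruxes.H413.K2E5QuatPoissonDilation
open Summit.HodgeConjecture.HodgeConjecture.Cruxes.H413.K2E5QuatSchwartzBruhatDilate
open scoped Matrix MatrixGroups NNReal ENNReal

variable (L : Type) [Field L] [NumberField L] [IsCMField L] {Ha : Matrix (Fin 2) (Fin 2) L}

/-! ## §1 The character argument of `quatFourierCoord` is the reduced-trace pairing -/

/-- **`(∑ᵢ (G b)ᵢ aᵢ) ⊗ 1 = tr(quatCoord e a · quatCoord e b)`** for `G = quatGramReal` (the Gram matrix `tr(eᵢeⱼ) ∈ L⁺`): the additive-character argument of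
★ `quatFourierCoord` is the reduced-trace pairing of `D_{h,𝔸}` read in `𝔸⁺` (★ `trace_quatCoord_mul_quatCoord`, ★ `AdeleRing.baseChange_algebraMap`).
[cite: VignerasLNM800, Ch. II §4 (Φ*(x) = ∫ Φ(y) ψ(t(xy)) dy); Ch. III §1 (t_A)] -/
theorem baseChange_sum_gram_mulVec_mul (hHa : (Ha.map (cmConjRingHom L)).transpose = Ha) (hdet : Ha.det ≠ 0)
    (a b : Fin 4 → AdeleRing (𝓞 ↥(maximalRealSubfield L)) ↥(maximalRealSubfield L)) :
    Automorphic.AdeleRing.baseChange (↥(maximalRealSubfield L)) L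
        (∑ i, (((quatGramReal L hdet (coe_quatBasis_mem L Ha hHa hdet)).map
          (algebraMap (↥(maximalRealSubfield L)) (AdeleRing (𝓞 ↥(maximalRealSubfield L)) ↥(maximalRealSubfield L)))) *ᵥ b) i * a i) =
      (quatCoord L (fun i => ((quatBasis L Ha hHa hdet i : ↥(quatRatSubalgebra L Ha)) : Matrix (Fin 2) (Fin 2) L)) a *
        quatCoord L (fun i => ((quatBasis L Ha hHa hdet i : ↥(quatRatSubalgebra L Ha)) : Matrix (Fin 2) (Fin 2) L)) b).trace := by
  rw [trace_quatCoord_mul_quatCoord, _root_.map_sum]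
  refine Finset.sum_congr rfl fun i _ => ?_
  rw [Matrix.mulVec, dotProduct, Finset.sum_mul, _root_.map_sum]
  refine Finset.sum_congr rfl fun j _ => ?_
  rw [Matrix.map_apply, map_mul, map_mul, map_mul, AdeleRing.baseChange_algebraMap]
  have hG : algebraMap L (AdeleRing (𝓞 L) L) (algebraMap (↥(maximalRealSubfield L)) L (quatGramReal L hdet (coe_quatBasis_mem L Ha hHa hdet) i j)) =
      algebraMap L (AdeleRing (𝓞 L) L)
        (quatGram L (fun i => ((quatBasis L Ha hHa hdet i : ↥(quatRatSubalgebra L Ha)) : Matrix (Fin 2) (Fin 2) L)) i j) := rfl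
  rw [hG]
  ring

/-! ## §2 The trd-Fourier transform of a dilated test function: `(Φ(x·))̂(b) = |x|⁻¹ Φ̂(b·x⁻¹)` -/

/-- `x⁻¹ · x = 1` for the matrices of a unit of `(D_h ⊗ 𝔸)^×` and its inverse. [folklore] -/
theorem coe_inv_mul_coe (x : ↥(quatAdelicUnits L Ha)) :
    (((x⁻¹ : ↥(quatAdelicUnits L Ha)) : GL (Fin 2) (AdeleRing (𝓞 L) L)) : Matrix (Fin 2) (Fin 2) (AdeleRing (𝓞 L) L)) *
        ((x : GL (Fin 2) (AdeleRing (𝓞 L) L)) : Matrix (Fin 2) (Fin 2) (AdeleRing (𝓞 L) L)) = 1 := by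
  rw [Subgroup.coe_inv, Units.inv_mul]

/-- `x · x⁻¹ = 1` for the matrices of a unit of `(D_h ⊗ 𝔸)^×` and its inverse. [folklore] -/
theorem coe_mul_coe_inv (x : ↥(quatAdelicUnits L Ha)) :
    ((x : GL (Fin 2) (AdeleRing (𝓞 L) L)) : Matrix (Fin 2) (Fin 2) (AdeleRing (𝓞 L) L)) *
        (((x⁻¹ : ↥(quatAdelicUnits L Ha)) : GL (Fin 2) (AdeleRing (𝓞 L) L)) : Matrix (Fin 2) (Fin 2) (AdeleRing (𝓞 L) L)) = 1 := by
  rw [Subgroup.coe_inv, Units.mul_inv]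

section Fourier

variable [MeasurableSpace (AdeleRing (𝓞 ↥(maximalRealSubfield L)) ↥(maximalRealSubfield L))]
  [BorelSpace (AdeleRing (𝓞 ↥(maximalRealSubfield L)) ↥(maximalRealSubfield L))]
  (ν4 : Measure (Fin 4 → AdeleRing (𝓞 ↥(maximalRealSubfield L)) ↥(maximalRealSubfield L))) [ν4.IsAddHaarMeasure]

omit [MeasurableSpace (AdeleRing (𝓞 ↥(maximalRealSubfield L)) ↥(maximalRealSubfield L))]
  [BorelSpace (AdeleRing (𝓞 ↥(maximalRealSubfield L)) ↥(maximalRealSubfield L))] in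
/-- **The dual dilation moves to the character side**: for `x ∈ (D_h ⊗ 𝔸)^×` and `a, b ∈ 𝔸⁺⁴`,
`⟨T_{x⁻¹} a, b⟩ = ⟨a, b·x⁻¹⟩` for the trd pairing `⟨a, b⟩ = ∑ᵢ (G b)ᵢ aᵢ`, where `T_{x⁻¹} a = quatCoordInv(x⁻¹ · quatCoord e a)` and
`b·x⁻¹ := quatCoordInv(quatCoord e b · x⁻¹)` — cyclicity `tr(x⁻¹ A B) = tr(A B x⁻¹)` read through the injective `𝔸⁺ → 𝔸_L` (§1).
[cite: VignerasLNM800, Ch. III §2 (proof of Thm. 2.2)] [cite: WeilBNT1967, Ch. VII §2 Prop. 2] -/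
theorem sum_gram_mulVec_mul_dilate_inv (hHa : (Ha.map (cmConjRingHom L)).transpose = Ha) (hdet : Ha.det ≠ 0) (x : ↥(quatAdelicUnits L Ha))
    (a b : Fin 4 → AdeleRing (𝓞 ↥(maximalRealSubfield L)) ↥(maximalRealSubfield L)) :
    ∑ i, (((quatGramReal L hdet (coe_quatBasis_mem L Ha hHa hdet)).map
          (algebraMap (↥(maximalRealSubfield L)) (AdeleRing (𝓞 ↥(maximalRealSubfield L)) ↥(maximalRealSubfield L)))) *ᵥ b) i *
        quatCoordInv L hHa hdet ((((x⁻¹ : ↥(quatAdelicUnits L Ha)) : GL (Fin 2) (AdeleRing (𝓞 L) L)) : Matrix (Fin 2) (Fin 2) (AdeleRing (𝓞 L) L)) *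
          quatCoord L (fun i => ((quatBasis L Ha hHa hdet i : ↥(quatRatSubalgebra L Ha)) : Matrix (Fin 2) (Fin 2) L)) a) i =
      ∑ i, (((quatGramReal L hdet (coe_quatBasis_mem L Ha hHa hdet)).map
          (algebraMap (↥(maximalRealSubfield L)) (AdeleRing (𝓞 ↥(maximalRealSubfield L)) ↥(maximalRealSubfield L)))) *ᵥ
            quatCoordInv L hHa hdet (quatCoord L (fun i => ((quatBasis L Ha hHa hdet i : ↥(quatRatSubalgebra L Ha)) : Matrix (Fin 2) (Fin 2) L)) b *
              (((x⁻¹ : ↥(quatAdelicUnits L Ha)) : GL (Fin 2) (AdeleRing (𝓞 L) L)) : Matrix (Fin 2) (Fin 2) (AdeleRing (𝓞 L) L)))) i * a i := by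
  apply AdeleRing.baseChange_injective (↥(maximalRealSubfield L)) L
  rw [baseChange_sum_gram_mulVec_mul L hHa hdet, baseChange_sum_gram_mulVec_mul L hHa hdet, quatCoord_dilate L hHa hdet x⁻¹ a,
    quatCoord_quatCoordInv L hHa hdet ((quatAdelic L Ha).mul_mem (quatCoord_mem_quatAdelic L Ha (coe_quatBasis_mem L Ha hHa hdet) b)
      (coe_coe_mem_quatAdelic L x⁻¹))]
  conv_rhs => rw [← Matrix.mul_assoc, Matrix.trace_mul_cycle]

/-- **THE trd-FOURIER TRANSFORM OF A DILATED TEST FUNCTION: `(Φ(x·))̂(b) = |x|⁻¹ · Φ̂(b·x⁻¹)`** for every unit `x ∈ (D_h ⊗ 𝔸)^×`, every additive Haar measure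
`ν4` on `𝔸⁺⁴`, every `Φ : M₂(𝔸_L) → ℂ` and every `b ∈ 𝔸⁺⁴`; here `Φ̂ = quatFourierCoord L ν4 G e Φ` (★ #3g), `|x|⁻¹ = quatModule x⁻¹` and `b·x⁻¹` is read in coordinates as
`quatCoordInv(quatCoord e b · x⁻¹)`.  Proof: the substitution `a ↦ T_x a` (★ `integral_quatCoord_mul_left`: `∫ F(x · quatCoord e a) dν4 = |x|⁻¹ ∫ F(quatCoord e a) dν4`)
applied to `F(m) = Φ(m)·ψ(⟨T_{x⁻¹}(coord m), b⟩)`, then `⟨T_{x⁻¹} a, b⟩ = ⟨a, b·x⁻¹⟩` (`sum_gram_mulVec_mul_dilate_inv`).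
[cite: VignerasLNM800, Ch. III §2 (proof of Thm. 2.2)] [cite: WeilBNT1967, Ch. VII §2 Prop. 2] [cite: TateThesis1967, §4.2] -/
theorem quatFourierCoord_comp_mul_left (hHa : (Ha.map (cmConjRingHom L)).transpose = Ha) (hdet : Ha.det ≠ 0) (x : ↥(quatAdelicUnits L Ha))
    (Φ : Matrix (Fin 2) (Fin 2) (AdeleRing (𝓞 L) L) → ℂ) (b : Fin 4 → AdeleRing (𝓞 ↥(maximalRealSubfield L)) ↥(maximalRealSubfield L)) :
    quatFourierCoord L ν4 (quatGramReal L hdet (coe_quatBasis_mem L Ha hHa hdet))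
        (fun i => ((quatBasis L Ha hHa hdet i : ↥(quatRatSubalgebra L Ha)) : Matrix (Fin 2) (Fin 2) L))
        (fun m => Φ (((x : GL (Fin 2) (AdeleRing (𝓞 L) L)) : Matrix (Fin 2) (Fin 2) (AdeleRing (𝓞 L) L)) * m)) b =
      (((quatModule L Ha x⁻¹ : ℝ≥0) : ℝ) : ℂ) *
        quatFourierCoord L ν4 (quatGramReal L hdet (coe_quatBasis_mem L Ha hHa hdet))
          (fun i => ((quatBasis L Ha hHa hdet i : ↥(quatRatSubalgebra L Ha)) : Matrix (Fin 2) (Fin 2) L)) Φ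
          (quatCoordInv L hHa hdet (quatCoord L (fun i => ((quatBasis L Ha hHa hdet i : ↥(quatRatSubalgebra L Ha)) : Matrix (Fin 2) (Fin 2) L)) b *
            (((x⁻¹ : ↥(quatAdelicUnits L Ha)) : GL (Fin 2) (AdeleRing (𝓞 L) L)) : Matrix (Fin 2) (Fin 2) (AdeleRing (𝓞 L) L)))) := by
  rw [quatFourierCoord_apply, quatFourierCoord_apply]
  -- the pairing and the auxiliary function `F(m) = Φ(m) ψ(⟨T_{x⁻¹}(coord m), b⟩)`
  set Gm : Matrix (Fin 4) (Fin 4) (AdeleRing (𝓞 ↥(maximalRealSubfield L)) ↥(maximalRealSubfield L)) :=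
    (quatGramReal L hdet (coe_quatBasis_mem L Ha hHa hdet)).map
      (algebraMap (↥(maximalRealSubfield L)) (AdeleRing (𝓞 ↥(maximalRealSubfield L)) ↥(maximalRealSubfield L))) with hGm
  set X : Matrix (Fin 2) (Fin 2) (AdeleRing (𝓞 L) L) := ((x : GL (Fin 2) (AdeleRing (𝓞 L) L)) : Matrix (Fin 2) (Fin 2) (AdeleRing (𝓞 L) L)) with hX
  set Xi : Matrix (Fin 2) (Fin 2) (AdeleRing (𝓞 L) L) :=
    (((x⁻¹ : ↥(quatAdelicUnits L Ha)) : GL (Fin 2) (AdeleRing (𝓞 L) L)) : Matrix (Fin 2) (Fin 2) (AdeleRing (𝓞 L) L)) with hXi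
  have hXiX : Xi * X = 1 := coe_inv_mul_coe L x
  let F : Matrix (Fin 2) (Fin 2) (AdeleRing (𝓞 L) L) → ℂ := fun m =>
    Φ m * (adeleAddChar (↥(maximalRealSubfield L))
      (∑ i, (Gm *ᵥ b) i * quatCoordInv L hHa hdet (Xi * m) i) : ℂ)
  -- the integrand of the left side is `F(x · quatCoord e a)`
  have hleft : (fun a => Φ (X * quatCoord L (fun i => ((quatBasis L Ha hHa hdet i : ↥(quatRatSubalgebra L Ha)) : Matrix (Fin 2) (Fin 2) L)) a) *
      (adeleAddChar (↥(maximalRealSubfield L)) (∑ i, (Gm *ᵥ b) i * a i) : ℂ)) =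
      fun a => F (X * quatCoord L (fun i => ((quatBasis L Ha hHa hdet i : ↥(quatRatSubalgebra L Ha)) : Matrix (Fin 2) (Fin 2) L)) a) := by
    funext a
    simp only [F]
    rw [← Matrix.mul_assoc, hXiX, Matrix.one_mul, quatCoordInv_quatCoord]
  -- the integrand of the right side is `F(quatCoord e a)`
  have hright : (fun a => F (quatCoord L (fun i => ((quatBasis L Ha hHa hdet i : ↥(quatRatSubalgebra L Ha)) : Matrix (Fin 2) (Fin 2) L)) a)) =
      fun a => Φ (quatCoord L (fun i => ((quatBasis L Ha hHa hdet i : ↥(quatRatSubalgebra L Ha)) : Matrix (Fin 2) (Fin 2) L)) a) *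
        (adeleAddChar (↥(maximalRealSubfield L))
          (∑ i, (Gm *ᵥ quatCoordInv L hHa hdet (quatCoord L (fun i => ((quatBasis L Ha hHa hdet i : ↥(quatRatSubalgebra L Ha)) :
            Matrix (Fin 2) (Fin 2) L)) b * Xi)) i * a i) : ℂ) := by
    funext a
    simp only [F]
    rw [sum_gram_mulVec_mul_dilate_inv L hHa hdet x a b]
  rw [hleft, integral_quatCoord_mul_left L ν4 hHa hdet x F, hright, Complex.real_smul]

end Fourier

/-! ## §3 Poisson summation for the dilated test function `Φ(x·)` -/

section Poisson

variable [MeasurableSpace (AdeleRing (𝓞 ↥(maximalRealSubfield L)) ↥(maximalRealSubfield L))]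
  [BorelSpace (AdeleRing (𝓞 ↥(maximalRealSubfield L)) ↥(maximalRealSubfield L))]
  (ν4 : Measure (Fin 4 → AdeleRing (𝓞 ↥(maximalRealSubfield L)) ↥(maximalRealSubfield L))) [ν4.IsAddHaarMeasure]

/-- **POISSON FOR `Φ(x·)`**: for `x ∈ (D_h ⊗ 𝔸)^×` and `Φ ∈ 𝒮(D_{h,𝔸})`,
`∑_{ξ ∈ D_h} Φ(x · (ξ ⊗ 1)) = ν4(F)⁻¹ · ∑_{η ∈ (L⁺)⁴} (Φ(x·))̂(η ⊗ 1)` — ★ `tsum_quatRat_eq_inv_measure_mul_tsum_quatFourierCoord_coord` applied to the Schwartz–Bruhat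
function `Φ(x·)` (★ `comp_mul_left_mem_quatSchwartzBruhat`).  Both sums converge absolutely (Schwartz–Bruhat on both sides).
[cite: VignerasLNM800, Ch. III §2 (proof of Thm. 2.2: formule de Poisson pour Φ(y·))] [cite: CasselsFrohlichANT1967, Ch. XV Lemma 4.2.4] -/
theorem tsum_quatRat_mul_left_eq_inv_measure_mul_tsum (hHa : (Ha.map (cmConjRingHom L)).transpose = Ha) (hdet : Ha.det ≠ 0)
    (x : ↥(quatAdelicUnits L Ha)) {Φ : Matrix (Fin 2) (Fin 2) (AdeleRing (𝓞 L) L) → ℂ}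
    (hΦ : Φ ∈ quatSchwartzBruhat L (fun i => ((quatBasis L Ha hHa hdet i : ↥(quatRatSubalgebra L Ha)) : Matrix (Fin 2) (Fin 2) L))) :
    ∑' ξ : ↥(quatRatSubalgebra L Ha), Φ (((x : GL (Fin 2) (AdeleRing (𝓞 L) L)) : Matrix (Fin 2) (Fin 2) (AdeleRing (𝓞 L) L)) *
        (ξ : Matrix (Fin 2) (Fin 2) L).map (algebraMap L (AdeleRing (𝓞 L) L))) =
      (ν4 (piFundamentalDomain (↥(maximalRealSubfield L)) (Fin 4))).toReal⁻¹ *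
        ∑' η : Fin 4 → ↥(maximalRealSubfield L),
          quatFourierCoord L ν4 (quatGramReal L hdet (coe_quatBasis_mem L Ha hHa hdet))
            (fun i => ((quatBasis L Ha hHa hdet i : ↥(quatRatSubalgebra L Ha)) : Matrix (Fin 2) (Fin 2) L))
            (fun m => Φ (((x : GL (Fin 2) (AdeleRing (𝓞 L) L)) : Matrix (Fin 2) (Fin 2) (AdeleRing (𝓞 L) L)) * m))
            (fun i => algebraMap (↥(maximalRealSubfield L)) (AdeleRing (𝓞 ↥(maximalRealSubfield L)) ↥(maximalRealSubfield L)) (η i)) :=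
  tsum_quatRat_eq_inv_measure_mul_tsum_quatFourierCoord_coord L ν4 hHa hdet (comp_mul_left_mem_quatSchwartzBruhat L hHa hdet x hΦ)

/-! ## §4 The theta inversion formula -/

/-- **THETA INVERSION (coordinate-lattice form): `∑_{ξ ∈ D_h} Φ(x(ξ ⊗ 1)) = ν4(F)⁻¹ · |x|⁻¹ · ∑_{η ∈ (L⁺)⁴} Φ̂((η ⊗ 1)·x⁻¹)`** for `x ∈ (D_h ⊗ 𝔸)^×` and
`Φ ∈ 𝒮(D_{h,𝔸})`, with `Φ̂ = quatFourierCoord L ν4 G e Φ`, `|x|⁻¹ = quatModule x⁻¹`, and `(η ⊗ 1)·x⁻¹` read in coordinates as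
`quatCoordInv(quatCoord e (η ⊗ 1) · x⁻¹)` (§3 + §2 termwise, Mathlib `tsum_mul_left`).
[cite: VignerasLNM800, Ch. III §2 (proof of Thm. 2.2: ∑ Φ(yx) = ‖y‖⁻¹ ∑ Φ*(xy⁻¹))] [cite: WeilBNT1967, Ch. VII §6] [cite: TateThesis1967, §4.2 Thm. 4.2.1] -/
theorem tsum_quatRat_mul_left_eq (hHa : (Ha.map (cmConjRingHom L)).transpose = Ha) (hdet : Ha.det ≠ 0)
    (x : ↥(quatAdelicUnits L Ha)) {Φ : Matrix (Fin 2) (Fin 2) (AdeleRing (𝓞 L) L) → ℂ}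
    (hΦ : Φ ∈ quatSchwartzBruhat L (fun i => ((quatBasis L Ha hHa hdet i : ↥(quatRatSubalgebra L Ha)) : Matrix (Fin 2) (Fin 2) L))) :
    ∑' ξ : ↥(quatRatSubalgebra L Ha), Φ (((x : GL (Fin 2) (AdeleRing (𝓞 L) L)) : Matrix (Fin 2) (Fin 2) (AdeleRing (𝓞 L) L)) *
        (ξ : Matrix (Fin 2) (Fin 2) L).map (algebraMap L (AdeleRing (𝓞 L) L))) =
      (ν4 (piFundamentalDomain (↥(maximalRealSubfield L)) (Fin 4))).toReal⁻¹ * ((((quatModule L Ha x⁻¹ : ℝ≥0) : ℝ) : ℂ) *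
        ∑' η : Fin 4 → ↥(maximalRealSubfield L),
          quatFourierCoord L ν4 (quatGramReal L hdet (coe_quatBasis_mem L Ha hHa hdet))
            (fun i => ((quatBasis L Ha hHa hdet i : ↥(quatRatSubalgebra L Ha)) : Matrix (Fin 2) (Fin 2) L)) Φ
            (quatCoordInv L hHa hdet
              (quatCoord L (fun i => ((quatBasis L Ha hHa hdet i : ↥(quatRatSubalgebra L Ha)) : Matrix (Fin 2) (Fin 2) L))
                  (fun i => algebraMap (↥(maximalRealSubfield L)) (AdeleRing (𝓞 ↥(maximalRealSubfield L)) ↥(maximalRealSubfield L)) (η i)) *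
                (((x⁻¹ : ↥(quatAdelicUnits L Ha)) : GL (Fin 2) (AdeleRing (𝓞 L) L)) : Matrix (Fin 2) (Fin 2) (AdeleRing (𝓞 L) L))))) := by
  rw [tsum_quatRat_mul_left_eq_inv_measure_mul_tsum L ν4 hHa hdet x hΦ]
  congr 1
  rw [← tsum_mul_left]
  exact tsum_congr fun η => quatFourierCoord_comp_mul_left L ν4 hHa hdet x Φ _

/-- **THETA INVERSION (intrinsic form, both sums over `D_h`): `∑_{ξ ∈ D_h} Φ(x(ξ ⊗ 1)) = ν4(F)⁻¹ · |x|⁻¹ · ∑_{y ∈ D_h} Φ̂((y ⊗ 1)·x⁻¹)`**, the dual term at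
`y ∈ D_h` being `quatFourierCoord L ν4 G e Φ (quatCoordInv((y ⊗ 1) · x⁻¹))` (★ `tsum_quatRatSubalgebra_eq_tsum_coord`, ★ `map_sum_smul_quatBasis_eq_quatCoord`).
This is the formula Tate's unfolding feeds into the `|x| < 1` half of the zeta integral (rung R4).
[cite: VignerasLNM800, Ch. III §2 (proof of Thm. 2.2)] [cite: WeilBNT1967, Ch. VII §6 (proof of Thm. 4)] [cite: TateThesis1967, §4.2 Thm. 4.2.1] -/
theorem tsum_quatRat_mul_left_eq_tsum_quatRat (hHa : (Ha.map (cmConjRingHom L)).transpose = Ha) (hdet : Ha.det ≠ 0)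
    (x : ↥(quatAdelicUnits L Ha)) {Φ : Matrix (Fin 2) (Fin 2) (AdeleRing (𝓞 L) L) → ℂ}
    (hΦ : Φ ∈ quatSchwartzBruhat L (fun i => ((quatBasis L Ha hHa hdet i : ↥(quatRatSubalgebra L Ha)) : Matrix (Fin 2) (Fin 2) L))) :
    ∑' ξ : ↥(quatRatSubalgebra L Ha), Φ (((x : GL (Fin 2) (AdeleRing (𝓞 L) L)) : Matrix (Fin 2) (Fin 2) (AdeleRing (𝓞 L) L)) *
        (ξ : Matrix (Fin 2) (Fin 2) L).map (algebraMap L (AdeleRing (𝓞 L) L))) =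
      (ν4 (piFundamentalDomain (↥(maximalRealSubfield L)) (Fin 4))).toReal⁻¹ * ((((quatModule L Ha x⁻¹ : ℝ≥0) : ℝ) : ℂ) *
        ∑' y : ↥(quatRatSubalgebra L Ha),
          quatFourierCoord L ν4 (quatGramReal L hdet (coe_quatBasis_mem L Ha hHa hdet))
            (fun i => ((quatBasis L Ha hHa hdet i : ↥(quatRatSubalgebra L Ha)) : Matrix (Fin 2) (Fin 2) L)) Φ
            (quatCoordInv L hHa hdet ((y : Matrix (Fin 2) (Fin 2) L).map (algebraMap L (AdeleRing (𝓞 L) L)) *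
              (((x⁻¹ : ↥(quatAdelicUnits L Ha)) : GL (Fin 2) (AdeleRing (𝓞 L) L)) : Matrix (Fin 2) (Fin 2) (AdeleRing (𝓞 L) L))))) := by
  rw [tsum_quatRat_mul_left_eq L ν4 hHa hdet x hΦ]
  have h := tsum_quatRatSubalgebra_eq_tsum_coord L hHa hdet (fun m : Matrix (Fin 2) (Fin 2) L =>
    quatFourierCoord L ν4 (quatGramReal L hdet (coe_quatBasis_mem L Ha hHa hdet))
      (fun i => ((quatBasis L Ha hHa hdet i : ↥(quatRatSubalgebra L Ha)) : Matrix (Fin 2) (Fin 2) L)) Φ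
      (quatCoordInv L hHa hdet (m.map (algebraMap L (AdeleRing (𝓞 L) L)) *
        (((x⁻¹ : ↥(quatAdelicUnits L Ha)) : GL (Fin 2) (AdeleRing (𝓞 L) L)) : Matrix (Fin 2) (Fin 2) (AdeleRing (𝓞 L) L)))))
  beta_reduce at h
  rw [h]
  refine congrArg _ (congrArg _ (tsum_congr fun η => ?_))
  rw [map_sum_smul_quatBasis_eq_quatCoord L hHa hdet η]

end Poisson

end Summit.HodgeConjecture.HodgeConjecture.Cruxes.H413.K2E5QuatThetaPoisson

end
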